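import Literature.Analysis.FluidPDE.PlanarVorticityMoments
import Literature.Analysis.FluidPDE.PlanarVorticityMaxPrinciple
import Literature.MeasureTheory.Integral.BathtubPrinciple
import HarnessLib

/-!
# A floor for the peak of a non-negative planar vorticity by its circulation and moment of inertia:
# `Γ² ≤ 2π ‖ω‖_∞ ∫|x|²ω` (bathtub principle), and its viscous evolution (Majda–Bertozzi Prop. 1.14)

Literature file (topic `Analysis/FluidPDE`), theorems only. Sources: E. H. Lieb, M. Loss,
*Analysis*, 2nd ed. (AMS GSM 14, 2001), Theorem 1.14 (bathtub principle, p. 28) — in the tree as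
`Literature.MeasureTheory.Integral.bathtub_integral_mul_ge`; here with the weight `w(x) = |x|²` on
`ℝ²` and the tub `{|x| < R}`, `A π R² = Γ`, whose value `A ∫_{|x|<R} |x|² dx = A π R⁴/2 = Γ²/(2πA)`
is the moment of inertia of the circular patch (Rankine vortex) of strength `A` and circulation
`Γ`: among planar vorticities `0 ≤ ω ≤ A` with `∫ω = Γ` the circular patch minimises `∫|x|²ω`,
so **`Γ² ≤ 2π A ∫|x|² ω`**, i.e. **`‖ω‖_∞ ≥ Γ²/(2π ∫|x|²ω)`** (equality for the patch).
A. J. Majda, A. L. Bertozzi, *Vorticity and Incompressible Flow* (CUP 2002): §1.7 Prop. 1.14,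
eq. (1.81) (held text p. 31) — `Ω₂ = ∫ω` conserved, `∫|x|²ω(t) = ∫|x|²ω(t₀) + 4ν(t − t₀)Ω₂` (tree:
`IsClassicalNSSolutionOn.planarVorticity_moments_eq`); §3.3 before Cor. 3.3 (p. 105) — the
minimum principle `ω(t₀) ≥ 0 ⇒ ω(t) ≥ 0` (tree: `IsClassicalNSSolutionOn.planarVorticity_ge_of_ge`).

## What is typed

* `integral_indicator_ball_norm_sq` — `∫_{|z|<R} |z|² dz = π R⁴/2` on `ℝ²` (polar coordinates,
  tree `integral_indicator_comp_norm`);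
* `sq_integral_le_two_pi_mul_integral_norm_sq_mul` — for `0 ≤ g ≤ A` on `ℝ²` with `g`, `|x|²g`
  integrable: `(∫g)² ≤ 2π A ∫|x|² g`; `div_le_of_sq_integral_le` form
  `(∫g)²/(2π∫|x|²g) ≤ A` (`le_of_integral_norm_sq_mul_pos`);
* `IsClassicalNSSolutionOn.sq_integral_planarVorticity_le_of_le` — for a classical planar
  Navier–Stokes solution on a convex time set `S` (`ν ≥ 0`, curl-free force, vorticity with uniform
  rapid decay on `S`, velocity = Biot–Savart velocity of its vorticity) with `ω(t₀) ≥ 0`: at every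
  later `t ∈ S`, EVERY pointwise bound `ω(t, ·) ≤ A` satisfies
  `Ω₂² ≤ 2π A (M(t₀) + 4ν(t − t₀)Ω₂)`, `Ω₂ = ∫ω(t₀)`, `M(t₀) = ∫|x|²ω(t₀)` — the current peak
  vorticity is floored by two conserved/explicit numbers of the initial datum;
  `IsClassicalNSSolutionOn.planarVorticity_peak_floor` — the same as
  `Ω₂²/(2π(M(t₀) + 4ν(t − t₀)Ω₂)) ≤ A` (`Ω₂ > 0`).

HONEST FRAMING (cell `ns-blowup`, bears_on LADDER-NS N1 crux `HeredityFromTwo`, readout half): a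
classical planar a-priori FLOOR complementing the maximum-principle CEILING; in the cell it is read
through Lundgren's transformation (the peak vorticity of a strained tube's cross-section is at least
`a(t)² Γ²/(2π M̃(τ(t)))` with `M̃` explicit). Nothing here concerns three-dimensional regularity.

## References

* [LiebLoss2001] E. H. Lieb, M. Loss, *Analysis*, 2nd ed., AMS GSM 14 (2001), Thm. 1.14 (bathtub
  principle), p. 28.
* [MajdaBertozziCUP2002] A. J. Majda, A. L. Bertozzi, CUP 2002 — §1.7 Prop. 1.14 (1.81) (held text
  p. 31); §3.3 before Cor. 3.3 (p. 105).
-/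

noncomputable section

open Set Function Filter MeasureTheory Metric InnerProductSpace
open scoped ContDiff RealInnerProductSpace Topology

namespace Literature.Analysis.FluidPDE

/-! ### The moment of inertia of the disk and the bathtub floor -/

section Static

/-- **`∫_{|z| < R} |z|² dz = π R⁴/2`** on `ℝ²` (`R ≥ 0`; polar coordinates: `2π ∫₀^R r³ dr`) — the
moment of inertia of the unit-strength circular patch, the bathtub value for the weight `|x|²`.
[cite: LiebLoss2001, Thm. 1.14 (bathtub principle), the value `∫_{w<s} w`; MajdaBertozziCUP2002, §8.2.3 proof of Lemma 8.1 (radial integrals on `ℝ²`, held text p. 280)] -/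
theorem integral_indicator_ball_norm_sq {R : ℝ} (hR : 0 ≤ R) :
    ∫ z, (ball (0 : EuclideanSpace ℝ (Fin 2)) R).indicator (fun z => ‖z‖ ^ 2) z =
      Real.pi * R ^ 4 / 2 := by
  have h1 : (fun z => (ball (0 : EuclideanSpace ℝ (Fin 2)) R).indicator (fun z => ‖z‖ ^ 2) z) =
      fun z : EuclideanSpace ℝ (Fin 2) => (Iio R).indicator (fun y => y ^ 2) ‖z‖ := by
    ext z
    by_cases hz : ‖z‖ < R
    · rw [indicator_of_mem (mem_ball_zero_iff.2 hz), indicator_of_mem (mem_Iio.2 hz)]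
    · rw [indicator_of_notMem (fun h => hz (mem_ball_zero_iff.1 h)),
        indicator_of_notMem (fun h => hz (mem_Iio.1 h))]
  rw [h1, integral_indicator_comp_norm _ measurableSet_Iio, Ioi_inter_Iio]
  have h3 : ∫ y in Ioo (0 : ℝ) R, y * y ^ 2 = ∫ y in Ioo (0 : ℝ) R, y ^ 3 :=
    setIntegral_congr_fun measurableSet_Ioo fun y _ => by ring
  rw [h3, setIntegral_congr_set Ioo_ae_eq_Ioc, ← intervalIntegral.integral_of_le hR, integral_pow]
  ring

/-- Set-integral form: `∫_{ball 0 R} |z|² dz = π R⁴/2` on `ℝ²`.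
[cite: LiebLoss2001, Thm. 1.14 (bathtub principle), the value `∫_{w<s} w`] -/
theorem setIntegral_ball_norm_sq {R : ℝ} (hR : 0 ≤ R) :
    ∫ z in ball (0 : EuclideanSpace ℝ (Fin 2)) R, ‖z‖ ^ 2 = Real.pi * R ^ 4 / 2 := by
  rw [← integral_indicator measurableSet_ball, integral_indicator_ball_norm_sq hR]

/-- **The circular patch minimises the moment of inertia** (Lieb–Loss bathtub principle with
`w = |x|²` on `ℝ²`): for a planar density `0 ≤ g ≤ A` with `g` and `|x|² g` integrable,
`(∫ g)² ≤ 2π A ∫ |x|² g` — equality for `g = A 𝟙_{|x|<R}`. Proof: the tub `{|x| < R}` with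
`A π R² = ∫ g` has `A ∫_{|x|<R}|x|² = A π R⁴/2 = (∫g)²/(2πA) ≤ ∫ |x|² g`
(`bathtub_integral_mul_ge`).
[cite: LiebLoss2001, Thm. 1.14 (bathtub principle), case `w(x) = |x|²`, `Ω = ℝ²`] -/
theorem sq_integral_le_two_pi_mul_integral_norm_sq_mul {g : EuclideanSpace ℝ (Fin 2) → ℝ} {A : ℝ}
    (h0 : ∀ x, 0 ≤ g x) (hA : ∀ x, g x ≤ A) (hgi : Integrable g)
    (hg2 : Integrable fun x => ‖x‖ ^ 2 * g x) :
    (∫ x, g x) ^ 2 ≤ 2 * Real.pi * A * ∫ x, ‖x‖ ^ 2 * g x := by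
  set Γ : ℝ := ∫ x, g x with hΓ
  set M : ℝ := ∫ x, ‖x‖ ^ 2 * g x with hM
  have hΓ0 : 0 ≤ Γ := integral_nonneg h0
  have hM0 : 0 ≤ M := integral_nonneg fun x => mul_nonneg (sq_nonneg _) (h0 x)
  have hA0 : 0 ≤ A := (h0 0).trans (hA 0)
  have hπ : 0 < Real.pi := Real.pi_pos
  rcases hΓ0.eq_or_lt with hz | hpos
  · rw [← hz, sq, zero_mul]; positivity
  -- `Γ > 0` forces `A > 0`
  have hApos : 0 < A := by
    by_contra hle
    have hg0 : ∀ x, g x = 0 := fun x => le_antisymm ((hA x).trans (not_lt.1 hle)) (h0 x)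
    have : Γ = 0 := by rw [hΓ]; simp [hg0]
    exact hpos.ne' this
  -- the tub: the disk of radius `R`, `A π R² = Γ`
  set R : ℝ := Real.sqrt (Γ / (Real.pi * A)) with hR
  have hR0 : 0 ≤ R := Real.sqrt_nonneg _
  have hRsq : R ^ 2 = Γ / (Real.pi * A) := Real.sq_sqrt (div_pos hpos (mul_pos hπ hApos)).le
  have hmass : A * (volume : Measure (EuclideanSpace ℝ (Fin 2))).real (ball 0 R) = Γ := by
    rw [Measure.real, EuclideanSpace.volume_ball_fin_two, ENNReal.toReal_mul, ENNReal.toReal_pow,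
      ENNReal.toReal_ofReal hR0, ENNReal.toReal_ofReal hπ.le, hRsq]
    field_simp
  have hwi : IntegrableOn (fun x : EuclideanSpace ℝ (Fin 2) => ‖x‖ ^ 2) (ball 0 R) volume :=
    ((continuous_norm.pow 2).continuousOn.integrableOn_compact (isCompact_closedBall 0 R)).mono_set
      ball_subset_closedBall
  have hb := Literature.MeasureTheory.Integral.bathtub_integral_mul_ge (μ := volume)
    (w := fun x : EuclideanSpace ℝ (Fin 2) => ‖x‖ ^ 2) (s := R ^ 2) measurableSet_ball
    measure_ball_lt_top.ne h0 hA
    (fun x hx => pow_le_pow_left₀ (norm_nonneg _) (mem_ball_zero_iff.1 hx).le 2)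
    (fun x hx => pow_le_pow_left₀ hR0 (not_lt.1 fun h => hx (mem_ball_zero_iff.2 h)) 2) hgi
    (by simpa only [mul_comm] using hg2) hwi
  rw [setIntegral_ball_norm_sq hR0, hmass, ← hΓ, sub_self, mul_zero, add_zero] at hb
  have hb' : A * (Real.pi * R ^ 4 / 2) ≤ M := by
    rw [hM]; refine hb.trans_eq (integral_congr_ae (Eventually.of_forall fun x => mul_comm _ _))
  -- `A π R⁴/2 = Γ²/(2πA)`
  have hval : A * (Real.pi * R ^ 4 / 2) = Γ ^ 2 / (2 * Real.pi * A) := by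
    rw [show R ^ 4 = (R ^ 2) ^ 2 by ring, hRsq]
    field_simp
  rw [hval, div_le_iff₀ (by positivity)] at hb'
  linarith

/-- Floor form: with `∫ |x|² g > 0`, **`(∫ g)²/(2π ∫|x|² g) ≤ A`** for every pointwise bound
`g ≤ A` of a planar density `g ≥ 0` — the peak is at least the Rankine value.
[cite: LiebLoss2001, Thm. 1.14 (bathtub principle), case `w(x) = |x|²`, `Ω = ℝ²`] -/
theorem sq_integral_div_le_of_le {g : EuclideanSpace ℝ (Fin 2) → ℝ} {A : ℝ}
    (h0 : ∀ x, 0 ≤ g x) (hA : ∀ x, g x ≤ A) (hgi : Integrable g)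
    (hg2 : Integrable fun x => ‖x‖ ^ 2 * g x) (hM : 0 < ∫ x, ‖x‖ ^ 2 * g x) :
    (∫ x, g x) ^ 2 / (2 * Real.pi * ∫ x, ‖x‖ ^ 2 * g x) ≤ A := by
  rw [div_le_iff₀ (by positivity)]
  have := sq_integral_le_two_pi_mul_integral_norm_sq_mul h0 hA hgi hg2
  linarith

end Static

/-! ### The viscous evolution of the floor (Majda–Bertozzi Prop. 1.14 + minimum principle) -/

section Planar

variable {S : Set ℝ} {ν : ℝ} {f u : ℝ → EuclideanSpace ℝ (Fin 2) → EuclideanSpace ℝ (Fin 2)}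
  {p : ℝ → EuclideanSpace ℝ (Fin 2) → ℝ}

/-- The scalar vorticity of a `C¹` planar field is continuous. [folklore] -/
private theorem continuous_planarVorticity' {v : EuclideanSpace ℝ (Fin 2) → EuclideanSpace ℝ (Fin 2)}
    (hv : ContDiff ℝ 1 v) : Continuous (PlanarEigenmode.vorticity v) := by
  have hc : ∀ e : EuclideanSpace ℝ (Fin 2), Continuous fun x => fderiv ℝ v x e := fun e =>
    (hv.continuous_fderiv one_ne_zero).clm_apply continuous_const
  have hcomp : ∀ (e : EuclideanSpace ℝ (Fin 2)) (i : Fin 2), Continuous fun x => fderiv ℝ v x e i :=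
    fun e i => (PiLp.continuous_apply _ _ i).comp (hc e)
  unfold PlanarEigenmode.vorticity
  exact (hcomp _ 1).sub (hcomp _ 0)

/-- Uniform rapid decay gives decay of `|ω|` near spatial infinity, uniformly in time. [folklore] -/
private theorem decay_of_hasUniformRapidDecayOn'' {S : Set ℝ}
    {w : ℝ → EuclideanSpace ℝ (Fin 2) → ℝ} (hw : HasUniformRapidDecayOn S w) (δ : ℝ) (hδ : 0 < δ) :
    ∃ R : ℝ, ∀ t ∈ S, ∀ x : EuclideanSpace ℝ (Fin 2), R ≤ ‖x‖ → |w t x| ≤ δ := by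
  obtain ⟨C, hC0, hC⟩ := hw.norm_le_rpow 1
  refine ⟨C / δ, fun t ht x hx => ?_⟩
  have h1 := hC t ht x
  rw [Real.norm_eq_abs, Nat.cast_one, Real.rpow_neg_one] at h1
  have hx0 : 0 < 1 + ‖x‖ := by positivity
  calc |w t x| ≤ C * (1 + ‖x‖)⁻¹ := h1
    _ ≤ δ := by
        rw [← div_eq_mul_inv, div_le_iff₀ hx0]
        have : C ≤ δ * ‖x‖ := by rwa [div_le_iff₀' hδ] at hx
        nlinarith

/-- A uniformly rapidly decaying planar vorticity and its second moment density are integrable at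
each time (`|w| ≤ C(1 + |x|)^{-5}`). [folklore] -/
private theorem integrable_sq_norm_mul_of_hasUniformRapidDecayOn {S : Set ℝ}
    {w : ℝ → EuclideanSpace ℝ (Fin 2) → ℝ} (hw : HasUniformRapidDecayOn S w) {t : ℝ} (ht : t ∈ S)
    (hc : Continuous (w t)) :
    Integrable (w t) (volume : Measure (EuclideanSpace ℝ (Fin 2))) ∧
      Integrable (fun x => ‖x‖ ^ 2 * w t x) (volume : Measure (EuclideanSpace ℝ (Fin 2))) := by
  obtain ⟨C, hC0, hC⟩ := hw.norm_le_rpow 5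
  have hfin : (Module.finrank ℝ (EuclideanSpace ℝ (Fin 2)) : ℝ) = 2 := by
    rw [finrank_euclideanSpace_fin]; norm_num
  refine ⟨integrable_of_norm_le_rpow_neg hc (C := C) (r := ((5 : ℕ) : ℝ)) (by rw [hfin]; norm_num)
      fun x => hC t ht x, ?_⟩
  refine integrable_of_norm_le_rpow_neg ((continuous_norm.pow 2).mul hc) (C := C) (r := 3)
    (by rw [hfin]; norm_num) fun x => ?_
  have h1 := hC t ht x
  have hx0 : 0 < 1 + ‖x‖ := by positivity
  have hx1 : ‖x‖ ^ 2 ≤ (1 + ‖x‖) ^ (2 : ℝ) := by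
    rw [show ((2 : ℝ)) = ((2 : ℕ) : ℝ) by norm_num, Real.rpow_natCast]
    exact pow_le_pow_left₀ (norm_nonneg _) (by linarith [norm_nonneg x]) 2
  rw [norm_mul, norm_pow, norm_norm]
  calc ‖x‖ ^ 2 * ‖w t x‖ ≤ (1 + ‖x‖) ^ (2 : ℝ) * (C * (1 + ‖x‖) ^ (-((5 : ℕ) : ℝ))) :=
        mul_le_mul hx1 h1 (norm_nonneg _) (by positivity)
    _ = C * (1 + ‖x‖) ^ (-(3 : ℝ)) := by
        rw [mul_left_comm, ← Real.rpow_add hx0]; norm_num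

/-- **The viscous evolution of the floor.** Let `(u, p)` be a classical planar Navier–Stokes solution
on a convex time set `S` with `ν ≥ 0` and curl-free force, whose vorticity `ω` has uniform rapid
decay on `S` and whose velocity is the Biot–Savart velocity of its vorticity, with `ω(t₀, ·) ≥ 0` at
`t₀ ∈ S`. Then at every `t ≥ t₀` in `S`, every pointwise bound `ω(t, ·) ≤ A` obeys
**`Ω₂² ≤ 2π A (M(t₀) + 4ν(t − t₀) Ω₂)`**, `Ω₂ = ∫ω(t₀)`, `M(t₀) = ∫|x|²ω(t₀)`: by the minimum
principle `ω(t) ≥ 0` (MB §3.3), the bathtub floor at time `t` reads `Ω₂(t)² ≤ 2π A M(t)`, and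
`Ω₂(t) = Ω₂`, `M(t) = M(t₀) + 4ν(t − t₀)Ω₂` (MB Prop. 1.14 (1.81)).
[cite: MajdaBertozziCUP2002, §1.7 Prop. 1.14 eq. (1.81) (held text p. 31); §3.3 before Cor. 3.3 (p. 105); LiebLoss2001, Thm. 1.14] -/
theorem IsClassicalNSSolutionOn.sq_integral_planarVorticity_le_of_le
    (h : IsClassicalNSSolutionOn S ν f u p) (hS : Convex ℝ S) (hν : 0 ≤ ν)
    (hcurl : ∀ t ∈ S, ∀ x, PlanarEigenmode.vorticity (f t) x = 0)
    (hω : HasUniformRapidDecayOn S (fun t x => PlanarEigenmode.vorticity (u t) x))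
    (hBS : ∀ t ∈ S, ∀ x, u t x = biotSavart2D (PlanarEigenmode.vorticity (u t)) x) {t₀ : ℝ}
    (ht₀ : t₀ ∈ S) (h0 : ∀ x, 0 ≤ PlanarEigenmode.vorticity (u t₀) x) {t : ℝ} (ht : t ∈ S)
    (htt : t₀ ≤ t) {A : ℝ} (hA : ∀ x, PlanarEigenmode.vorticity (u t) x ≤ A) :
    (∫ y, PlanarEigenmode.vorticity (u t₀) y) ^ 2 ≤
      2 * Real.pi * A * ((∫ y, ‖y‖ ^ 2 * PlanarEigenmode.vorticity (u t₀) y) +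
        4 * ν * (t - t₀) * ∫ y, PlanarEigenmode.vorticity (u t₀) y) := by
  -- the vorticity stays non-negative (minimum principle on the slab `[t₀, t] ⊆ S`)
  have hlo : ∀ y, 0 ≤ PlanarEigenmode.vorticity (u t) y := by
    rcases eq_or_lt_of_le htt with he | hlt
    · subst he; exact h0
    have hsub : Icc t₀ t ⊆ S := hS.ordConnected.out ht₀ ht
    have h' : IsClassicalNSSolutionOn (Icc t₀ t) ν f u p := h.mono hsub (uniqueDiffOn_Icc hlt)
    have hdec : ∀ δ : ℝ, 0 < δ → ∃ R : ℝ, ∀ s ∈ Icc t₀ t, ∀ y : EuclideanSpace ℝ (Fin 2),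
        R ≤ ‖y‖ → |PlanarEigenmode.vorticity (u s) y| ≤ δ := fun δ hδ => by
      obtain ⟨R, hR⟩ := decay_of_hasUniformRapidDecayOn'' hω δ hδ
      exact ⟨R, fun s hs y hy => hR s (hsub hs) y hy⟩
    exact fun y =>
      h'.planarVorticity_ge_of_ge hν (fun s hs z => (hcurl s (hsub hs) z).symm.le) hdec h0
        (right_mem_Icc.2 htt) y
  -- integrability at time `t`
  have hωc : Continuous (PlanarEigenmode.vorticity (u t)) :=
    continuous_planarVorticity' (contDiff_infty.1 (h.contDiff_velocity ht) 1)
  obtain ⟨hωi, hω2⟩ := integrable_sq_norm_mul_of_hasUniformRapidDecayOn hω ht hωc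
  -- the static floor at time `t`, then MB Prop. 1.14
  have hst := sq_integral_le_two_pi_mul_integral_norm_sq_mul hlo hA hωi hω2
  obtain ⟨hΓ, -, hM⟩ := h.planarVorticity_moments_eq hS hω hBS hcurl ht₀ ht 0
  rwa [hΓ, hM] at hst

/-- **Peak floor, explicit form**: under the same hypotheses with `Ω₂ = ∫ω(t₀) > 0`, every bound
`ω(t, ·) ≤ A` at a later time `t ∈ S` satisfies **`Ω₂²/(2π (M(t₀) + 4ν(t − t₀)Ω₂)) ≤ A`** — the
peak vorticity can decay no faster than the spreading Rankine/Lamb–Oseen rate `∼ Ω₂/(8πνt)`.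
[cite: MajdaBertozziCUP2002, §1.7 Prop. 1.14 eq. (1.81) (held text p. 31); §3.3 before Cor. 3.3 (p. 105); LiebLoss2001, Thm. 1.14] -/
theorem IsClassicalNSSolutionOn.planarVorticity_peak_floor
    (h : IsClassicalNSSolutionOn S ν f u p) (hS : Convex ℝ S) (hν : 0 ≤ ν)
    (hcurl : ∀ t ∈ S, ∀ x, PlanarEigenmode.vorticity (f t) x = 0)
    (hω : HasUniformRapidDecayOn S (fun t x => PlanarEigenmode.vorticity (u t) x))
    (hBS : ∀ t ∈ S, ∀ x, u t x = biotSavart2D (PlanarEigenmode.vorticity (u t)) x) {t₀ : ℝ}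
    (ht₀ : t₀ ∈ S) (h0 : ∀ x, 0 ≤ PlanarEigenmode.vorticity (u t₀) x)
    (hΓ : 0 < ∫ y, PlanarEigenmode.vorticity (u t₀) y) {t : ℝ} (ht : t ∈ S) (htt : t₀ ≤ t)
    {A : ℝ} (hA : ∀ x, PlanarEigenmode.vorticity (u t) x ≤ A) :
    (∫ y, PlanarEigenmode.vorticity (u t₀) y) ^ 2 /
        (2 * Real.pi * ((∫ y, ‖y‖ ^ 2 * PlanarEigenmode.vorticity (u t₀) y) +
          4 * ν * (t - t₀) * ∫ y, PlanarEigenmode.vorticity (u t₀) y)) ≤ A := by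
  have hm := h.sq_integral_planarVorticity_le_of_le hS hν hcurl hω hBS ht₀ h0 ht htt hA
  set Γ : ℝ := ∫ y, PlanarEigenmode.vorticity (u t₀) y
  set Mt : ℝ := (∫ y, ‖y‖ ^ 2 * PlanarEigenmode.vorticity (u t₀) y) + 4 * ν * (t - t₀) * Γ
  have hπ : 0 < Real.pi := Real.pi_pos
  -- `A > 0` and `M(t) > 0` from `Γ² > 0`
  have hΓ2 : 0 < Γ ^ 2 := by positivity
  have hAM : 0 < A * Mt := by nlinarith
  have hApos : 0 < A := by
    -- `ω(t) ≤ A ≤ 0` would give `Γ = Γ(t) = ∫ω(t) ≤ 0`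
    by_contra hle
    replace hle : A ≤ 0 := not_lt.1 hle
    have hΓt : (∫ y, PlanarEigenmode.vorticity (u t) y) = Γ :=
      (h.planarVorticity_moments_eq hS hω hBS hcurl ht₀ ht 0).1
    have : (∫ y, PlanarEigenmode.vorticity (u t) y) ≤ 0 :=
      integral_nonpos fun y => (hA y).trans hle
    linarith
  have hMt : 0 < Mt := pos_of_mul_pos_right hAM hApos.le
  rw [div_le_iff₀ (by positivity)]
  linarith
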